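import Mathlib.Analysis.ODE.Gronwall
import Mathlib.Analysis.SpecialFunctions.Sqrt
import Mathlib.MeasureTheory.Integral.IntervalIntegral.FundThmCalculus
import Mathlib.MeasureTheory.Integral.IntervalIntegral.Basic

/-!
# The strain-currency Grönwall lemma in square-root form (variable rate, constant forcing)

Cell `ns-blowup`, seat `ns-palasek-19179-p2` (g6; holder-of-record lineage of crux
stmt-NavierStokesRegularity-19179 `EpisodeBase`, route `PalasekTowerBreakdown`; `--supports
stmt-NavierStokesRegularity-19179`). Support for the stub `stub_strain_door : StrainDoor` of the strategist line
`Cruxes/EpisodeBase/Lines/straindoor.lean` (cstrat-19179, v2). LABEL: E–C analysis (KERNEL: theorems only; no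
definition, no named fact, no `sorry`; register-free — a statement about real functions). WHAT THIS IS NOT: not
Navier–Stokes evidence — an ODE comparison lemma; no flow, run, design or blow-up is exhibited or asserted.

The door's energy inequality has the shape `E' ≤ 2σ(t) E + 2G √E` (`E = E_κ(t) ≥ 0` the weighted energy of the
difference, `σ ≥ 0` the continuous strain-currency rate — by Parts I–IV of `…StrainPairing*` the pure-strain
coefficient — and `G ≥ 0` the constant residual defect); the conclusion used by `StrainBudgetOn.threshold/closeness`
is `√E(t) ≤ (√E(t₀) + G (t − t₀)) · exp (∫_{t₀}^t σ)` (i.e. `B e^{Λ/2}` with `B = D + T·G`). This file proves exactly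
that real-variable step:

* `sqrt_le_gronwall_of_deriv_le` — if `E` is continuous on `[t₀, t₁]`, nonnegative, right-differentiable on
  `[t₀, t₁)` with `E' ≤ 2σE + 2G√E`, `σ` continuous and nonnegative, `G ≥ 0`, then for `t ∈ [t₀, t₁]`
  `√(E t) ≤ (√(E t₀) + G (t − t₀)) exp (∫_{t₀}^t σ)`. Proof: for `η > 0` the function
  `z = √(E + η) · exp (−∫σ)` has right derivative `≤ G` (the `η` makes the square root differentiable), so Mathlib's
  Grönwall bound with `K = 0` gives `z(t) ≤ z(t₀) + G (t − t₀)`; then `η → 0`.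

References: P. Constantin, C. Foias, *Navier–Stokes Equations*, 1988, Ch. 10 (Grönwall with an integrable
coefficient, Remark 10.3) [cite: ConstantinFoiasNSE1988, Ch. 10 Thm. 10.2]; M. Dashti, J. C. Robinson, SIAM J.
Numer. Anal. 46 (2008), Thm. 5 (the a-posteriori shape `(D + T·G) e^{Λ}`) [cite: DashtiRobinson2008, Thm. 5].
-/

noncomputable section

set_option linter.dupNamespace false

open MeasureTheory Filter Set intervalIntegral
open scoped Topology

namespace Summit.NavierStokesRegularity.NavierStokesRegularity.Theorems.StrainPairing

/-- **Square-root Grönwall with a variable nonnegative rate and constant forcing.** Let `E` be continuous on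
`[t₀, t₁]`, nonnegative, with right derivative `E' t` within `[t, ∞)` at every `t ∈ [t₀, t₁)` satisfying
`E' t ≤ 2 σ(t) E(t) + 2 G √(E t)`, where `σ` is continuous and nonnegative and `G ≥ 0`. Then
`√(E t) ≤ (√(E t₀) + G (t − t₀)) · exp (∫_{t₀}^t σ)` on `[t₀, t₁]`. [cite: ConstantinFoiasNSE1988, Ch. 10 Thm. 10.2]
[cite: DashtiRobinson2008, Thm. 5] -/
theorem sqrt_le_gronwall_of_deriv_le {E E' σ : ℝ → ℝ} {t₀ t₁ G : ℝ}
    (hE : ContinuousOn E (Icc t₀ t₁)) (hE' : ∀ t ∈ Ico t₀ t₁, HasDerivWithinAt E (E' t) (Ici t) t)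
    (hE0 : ∀ t ∈ Icc t₀ t₁, 0 ≤ E t) (hσ : Continuous σ) (hσ0 : ∀ t, 0 ≤ σ t) (hG : 0 ≤ G)
    (hineq : ∀ t ∈ Ico t₀ t₁, E' t ≤ 2 * σ t * E t + 2 * G * Real.sqrt (E t)) :
    ∀ t ∈ Icc t₀ t₁, Real.sqrt (E t) ≤ (Real.sqrt (E t₀) + G * (t - t₀)) * Real.exp (∫ s in t₀..t, σ s) := by
  intro t ht
  -- the primitive of the rate and its derivative
  set P : ℝ → ℝ := fun u => ∫ s in t₀..u, σ s with hP
  have hPd : ∀ u, HasDerivAt P (σ u) u := fun u => (hσ.integral_hasStrictDerivAt t₀ u).hasDerivAt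
  have hPc : Continuous P := continuous_iff_continuousAt.2 fun u => (hPd u).continuousAt
  have hP0 : ∀ u, t₀ ≤ u → 0 ≤ P u := fun u hu =>
    intervalIntegral.integral_nonneg hu fun s _ => hσ0 s
  -- the regularised square root for `η > 0`, and the limit `η → 0`
  suffices key : ∀ η : ℝ, 0 < η →
      Real.sqrt (E t + η) ≤ (Real.sqrt (E t₀ + η) + G * (t - t₀)) * Real.exp (P t) by
    have hlim : Tendsto (fun η : ℝ => (Real.sqrt (E t₀ + η) + G * (t - t₀)) * Real.exp (P t))
        (𝓝[>] (0 : ℝ)) (𝓝 ((Real.sqrt (E t₀ + 0) + G * (t - t₀)) * Real.exp (P t))) := by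
      refine ((((continuous_const.add continuous_id).sqrt.add continuous_const).mul
        continuous_const).continuousAt.tendsto).mono_left nhdsWithin_le_nhds
    rw [add_zero] at hlim
    refine ge_of_tendsto hlim ?_
    filter_upwards [self_mem_nhdsWithin] with η hη
    have hη' : 0 < η := hη
    exact (Real.sqrt_le_sqrt (by linarith : E t ≤ E t + η)).trans (key η hη')
  intro η hη
  -- `z = √(E + η) · exp (−P)` and its right derivative
  set f : ℝ → ℝ := fun u => Real.sqrt (E u + η) with hf
  set z : ℝ → ℝ := fun u => f u * Real.exp (-P u) with hz
  have hfpos : ∀ u ∈ Icc t₀ t₁, 0 < E u + η := fun u hu => by linarith [hE0 u hu]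
  have hfc : ContinuousOn f (Icc t₀ t₁) := (hE.add continuousOn_const).sqrt
  have hzc : ContinuousOn z (Icc t₀ t₁) := hfc.mul (hPc.neg.rexp.continuousOn)
  set z' : ℝ → ℝ := fun u => E' u / (2 * Real.sqrt (E u + η)) * Real.exp (-P u) +
    f u * (Real.exp (-P u) * (-σ u)) with hz'
  have hzd : ∀ u ∈ Ico t₀ t₁, HasDerivWithinAt z (z' u) (Ici u) u := by
    intro u hu
    have h1 : HasDerivWithinAt f (E' u / (2 * Real.sqrt (E u + η))) (Ici u) u :=
      ((hE' u hu).add_const η).sqrt (hfpos u (Ico_subset_Icc_self hu)).ne'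
    have h2 : HasDerivWithinAt (fun s => Real.exp (-P s)) (Real.exp (-P u) * (-σ u)) (Ici u) u :=
      ((hPd u).neg.hasDerivWithinAt).exp
    exact h1.mul h2
  -- the derivative bound `z' ≤ G` (`= 0 · z + G`)
  have hbound : ∀ u ∈ Ico t₀ t₁, z' u ≤ 0 * z u + G := by
    intro u hu
    have hu' : u ∈ Icc t₀ t₁ := Ico_subset_Icc_self hu
    have hEu : 0 ≤ E u := hE0 u hu'
    have hfu : 0 < Real.sqrt (E u + η) := Real.sqrt_pos.2 (hfpos u hu')
    have hexp : 0 < Real.exp (-P u) := Real.exp_pos _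
    have hexp1 : Real.exp (-P u) ≤ 1 := by
      rw [Real.exp_le_one_iff]; linarith [hP0 u hu.1]
    have hsE : Real.sqrt (E u) ≤ Real.sqrt (E u + η) := Real.sqrt_le_sqrt (by linarith)
    have hEle : E u ≤ Real.sqrt (E u + η) * Real.sqrt (E u + η) := by
      rw [Real.mul_self_sqrt (hfpos u hu').le]; linarith
    rw [zero_mul, zero_add, hz']
    simp only [hf]
    -- `z' = e^{-P} (E'/(2f) − σ f) ≤ e^{-P} ((2σE + 2G√E)/(2f) − σ f) ≤ e^{-P} G ≤ G`
    have hkey : E' u / (2 * Real.sqrt (E u + η)) - Real.sqrt (E u + η) * σ u ≤ G := by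
      have h1 : E' u / (2 * Real.sqrt (E u + η)) ≤
          (2 * σ u * E u + 2 * G * Real.sqrt (E u)) / (2 * Real.sqrt (E u + η)) :=
        div_le_div_of_nonneg_right (hineq u hu) (by positivity)
      have h2 : (2 * σ u * E u + 2 * G * Real.sqrt (E u)) / (2 * Real.sqrt (E u + η)) =
          σ u * (E u / Real.sqrt (E u + η)) + G * (Real.sqrt (E u) / Real.sqrt (E u + η)) := by
        field_simp
      have h3 : E u / Real.sqrt (E u + η) ≤ Real.sqrt (E u + η) := by
        rw [div_le_iff₀ hfu]; exact hEle
      have h4 : Real.sqrt (E u) / Real.sqrt (E u + η) ≤ 1 := by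
        rw [div_le_one hfu]; exact hsE
      have h5 : σ u * (E u / Real.sqrt (E u + η)) ≤ σ u * Real.sqrt (E u + η) :=
        mul_le_mul_of_nonneg_left h3 (hσ0 u)
      have h6 : G * (Real.sqrt (E u) / Real.sqrt (E u + η)) ≤ G * 1 := mul_le_mul_of_nonneg_left h4 hG
      linarith [h1, h2.le, h2.ge]
    have hfac : E' u / (2 * Real.sqrt (E u + η)) * Real.exp (-P u) +
        Real.sqrt (E u + η) * (Real.exp (-P u) * -σ u) =
        Real.exp (-P u) * (E' u / (2 * Real.sqrt (E u + η)) - Real.sqrt (E u + η) * σ u) := by ring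
    rw [hfac]
    calc Real.exp (-P u) * (E' u / (2 * Real.sqrt (E u + η)) - Real.sqrt (E u + η) * σ u)
        ≤ Real.exp (-P u) * G := mul_le_mul_of_nonneg_left hkey hexp.le
      _ ≤ 1 * G := mul_le_mul_of_nonneg_right hexp1 hG
      _ = G := one_mul G
  -- Grönwall with `K = 0`
  have hgr := le_gronwallBound_of_liminf_deriv_right_le hzc
    (fun u hu r hr => (hzd u hu).liminf_right_slope_le hr) (le_refl (z t₀)) hbound t ht
  rw [gronwallBound_K0] at hgr
  -- unfold `z` and conclude
  have hz0 : z t₀ = Real.sqrt (E t₀ + η) := by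
    simp only [hz, hf, hP, intervalIntegral.integral_same, neg_zero, Real.exp_zero, mul_one]
  have hzt : z t = Real.sqrt (E t + η) * Real.exp (-P t) := rfl
  rw [hz0, hzt] at hgr
  have hexp : 0 < Real.exp (P t) := Real.exp_pos _
  have hmul : Real.sqrt (E t + η) = Real.sqrt (E t + η) * Real.exp (-P t) * Real.exp (P t) := by
    rw [mul_assoc, ← Real.exp_add, neg_add_cancel, Real.exp_zero, mul_one]
  rw [hmul]
  exact mul_le_mul_of_nonneg_right hgr hexp.le

end Summit.NavierStokesRegularity.NavierStokesRegularity.Theorems.StrainPairing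

end
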